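import Literature.NumberTheory.Automorphic.UnboundedDenominatorsDilationProofs
import HarnessLib

/-!
# The unbounded denominators theorem (Calegari–Dimitrov–Tang) — §4.2/4.3: `M_{N'}^{Γ(N)} = M_N` and `M_{Np} ∩ R_N = M_N`

PROOF-ONLY sequel (no definition, no named fact; D-0026) of `UnboundedDenominatorsFields.lean`,
`UnboundedDenominatorsFieldsProofs.lean` and `UnboundedDenominatorsDilationProofs.lean`. Source:
F. Calegari, V. Dimitrov, Y. Tang, *The unbounded denominators conjecture*, J. Amer. Math. Soc. **38**
(2025), 627–702 = arXiv:2109.09040, §4.2 Lemma 4.2.3 ("`M_N` may be identified with the field of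
rational functions on the modular curve `Y(N)/ℚ`") and §4.3, proof of Theorem 4.3.2 ("because the
intersection of `M_{Np}` and `R_N` is `M_N`").

## The rationality input, in hypothesis form

CDT's identification of `M_N` with the function field of `Y(N)` rests on the `ℚ`-structure of
`X(N)` ("the cusp `i∞` is defined over `ℚ`, and the action of `Gal(ℚ̄/ℚ)` on the global sections is
compatible with the `q`-expansion map"); concretely, on the fact that the spaces `M_k(Γ(N))` are
spanned by forms with RATIONAL `q_N`-expansions (G. Shimura, *Introduction to the arithmetic theory
of automorphic functions* (1971), Theorem 3.52). In the tree's language this is the statement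

  `(hrat N) : ∀ m (F : ModularForm Γ(N) (12m)), F/Δᵐ ∈ levelField N`

(`levelField N` being generated by the forms with INTEGRAL expansion). It is taken below as an inline
hypothesis — deliberately NOT a named fact (D-0026; filing it is the planner's call). Everything else
is PROVED:

* §1 level-`Γ(N')` modular functions (`F/Δᵐ`, `F ∈ M_{12m}(Γ(N'))`, complex coefficients) are
  closed under `0, 1, +, ·, c•`, under the action of ALL of `SL(2, ℤ)` (normality of `Γ(N')`:
  `exists_translate`, `smul_modFun_eq_of_coe_eq_slash`), and contain the `ℂ`-span of `levelGens N'`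
  (`isLvl_of_mem_span`);
* §2 under `hrat N'`: `M_{N'}` is stable under `SL(2, ℤ)` (`smul_mem_levelField`);
* §3 under `hrat N`: **`M_{N'} ∩ Mer^{Γ(N)} ⊆ M_N`** for `N ∣ N'` (`levelField_inf_invariantField_Gamma_le_levelField`) —
  the fixed field of `Γ(N)` on `M_{N'}` is `M_N` — by the NORM TRICK: `x = a/b` with `a, b` level-`Γ(N')`
  functions; `b̃ = ∏_{σ ∈ SL₂(ℤ)/Γ(N')} σ•b` is `SL(2, ℤ)`-invariant and `x = (x b̃)/b̃` with `x b̃ = a·∏_{σ≠1}σ•b`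
  a `Γ(N)`-invariant level-`Γ(N')` function, i.e. (bundling) a level-`Γ(N)` function, in `M_N` by
  `hrat N`;
* §4 ★ **"the intersection of `M_{Np}` and `R_N` is `M_N`"** (`bddDenField_inf_levelField_eq`): under
  `hrat N` and finite generation of `R_N`, `R_N ∩ M_{N'} = M_N` for `N ∣ N'` (with
  `bddDenField_inf_levelField_le_invariantField` of the Fields-Proofs file: `R_N` is fixed by a
  level-`N` group `G_N`, `M_{N'}` by `Γ(N')`, so the intersection is `Γ(N)`-fixed by Wohlfahrt).

## References

* [CalegariDimitrovTang2025] F. Calegari, V. Dimitrov, Y. Tang, The unbounded denominators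
  conjecture, J. Amer. Math. Soc. 38 (2025), no. 3, 627–702; arXiv:2109.09040. §4.2 Lemma 4.2.3,
  §4.3 proof of Theorem 4.3.2.
* G. Shimura, Introduction to the arithmetic theory of automorphic functions, Princeton 1971,
  Theorem 3.52 (rational structure of `M_k(Γ(N))`) — the source of the hypothesis `hrat`.
-/

noncomputable section

namespace Literature.NumberTheory.Automorphic

open scoped MatrixGroups ModularForm Manifold Pointwise
open UpperHalfPlane CongruenceSubgroup Matrix.SpecialLinearGroup ModularGroup

namespace UnboundedDenominators

/-! ### §1. Level-`Γ(N')` modular functions -/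

section level

variable {N' : ℕ}

/-- The image of `Γ(N')` in `GL₂(ℝ)` is normalised by the image of `SL(2, ℤ)`:
`γ⁻¹ Γ(N') γ = Γ(N')` as subgroups of `GL₂(ℝ)`. [folklore] -/
private theorem conjAct_smul_Gamma_map (N' : ℕ) (γ : SL(2, ℤ)) :
    ConjAct.toConjAct (mapGL ℝ γ)⁻¹ • ((Gamma N' : Subgroup SL(2, ℤ)) : Subgroup (GL (Fin 2) ℝ)) =
      ((Gamma N' : Subgroup SL(2, ℤ)) : Subgroup (GL (Fin 2) ℝ)) := by
  ext x
  rw [map_inv, Subgroup.mem_inv_pointwise_smul_iff, ConjAct.toConjAct_smul]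
  constructor
  · rintro ⟨y, hy, hyx⟩
    refine ⟨γ⁻¹ * y * γ, (Gamma_normal N').conj_mem' y hy γ, ?_⟩
    rw [map_mul, map_mul, map_inv, hyx]
    group
  · rintro ⟨y, hy, rfl⟩
    refine ⟨γ * y * γ⁻¹, (Gamma_normal N').conj_mem y hy γ, ?_⟩
    rw [map_mul, map_mul, map_inv]

/-- **Translates of level-`Γ(N')` forms are level-`Γ(N')` forms** (`Γ(N')` is normal in `SL(2, ℤ)`):
for `F ∈ M_k(Γ(N'))` and `γ ∈ SL(2, ℤ)`, `F ∣ₖ γ ∈ M_k(Γ(N'))` (Mathlib's `ModularForm.translate`,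
transported along `γ⁻¹ Γ(N') γ = Γ(N')`). [cite: CalegariDimitrovTang2025, Lemma 4.2.3 ("the
action … is compatible with the `q`-expansion map")] -/
theorem exists_translate {k : ℤ}
    (F : ModularForm ((Gamma N' : Subgroup SL(2, ℤ)) : Subgroup (GL (Fin 2) ℝ)) k) (γ : SL(2, ℤ)) :
    ∃ F' : ModularForm ((Gamma N' : Subgroup SL(2, ℤ)) : Subgroup (GL (Fin 2) ℝ)) k,
      (F' : ℍ → ℂ) = (⇑F : ℍ → ℂ) ∣[k] γ :=
  ⟨(ModularForm.translate F (mapGL ℝ γ)).mcast rfl (conjAct_smul_Gamma_map N' γ).symm, rfl⟩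

/-- **The action on `F/Δᵐ` is the slash action on `F`**: if `⇑F' = F ∣_{12m} γ` then
`γ⁻¹ • (F/Δᵐ) = F'/Δᵐ`, i.e. `(F/Δᵐ)(γ • τ) = (F ∣ γ)(τ)/Δ(τ)ᵐ` (the automorphy factors of `F` and
`Δᵐ` cancel). [cite: CalegariDimitrovTang2025, §4.2 (Definition 4.2.1)] -/
theorem smul_modFun_eq_of_coe_eq_slash {Γ Γ' : Subgroup (GL (Fin 2) ℝ)} {m : ℕ}
    (F : ModularForm Γ (12 * (m : ℤ))) (F' : ModularForm Γ' (12 * (m : ℤ))) (γ : SL(2, ℤ))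
    (h : (F' : ℍ → ℂ) = (⇑F : ℍ → ℂ) ∣[12 * (m : ℤ)] γ) : γ⁻¹ • modFun m F = modFun m F' := by
  ext τ
  rw [smul_hol_apply, inv_inv, modFun_apply, modFun_apply, h, ModularForm.SL_slash_apply]
  have hΔ : ModularForm.discriminant (γ • τ) =
      denom γ τ ^ (12 : ℤ) * ModularForm.discriminant τ := by
    have h := SlashInvariantForm.slash_action_eqn'' (CuspForm.discriminant)
      (γ := (γ : GL (Fin 2) ℝ)) (MonoidHom.mem_range.mpr ⟨γ, rfl⟩) τ
    simpa only [CuspForm.coe_discriminant, sl_moeb] using h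
  have hd : denom γ τ ≠ 0 := denom_ne_zero γ τ
  rw [hΔ, mul_pow, ← zpow_natCast (denom γ τ ^ (12 : ℤ)), ← zpow_mul, zpow_neg]
  field_simp

/-- Powers of `Δ` as modular forms on `Γ(N')`. [folklore] -/
private theorem exists_discriminant_pow_Gamma (N' : ℕ) (j : ℕ) :
    ∃ D : ModularForm ((Gamma N' : Subgroup SL(2, ℤ)) : Subgroup (GL (Fin 2) ℝ)) (12 * (j : ℤ)),
      (D : ℍ → ℂ) = ModularForm.discriminant ^ j := by
  have hΓ : (((⊤ : Subgroup SL(2, ℤ)) : Subgroup (GL (Fin 2) ℝ))) = 𝒮ℒ :=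
    (MonoidHom.range_eq_map (mapGL ℝ : SL(2, ℤ) →* GL (Fin 2) ℝ)).symm
  let Δ₁ : ModularForm (((⊤ : Subgroup SL(2, ℤ)) : Subgroup (GL (Fin 2) ℝ))) 12 :=
    (CuspForm.discriminant : ModularForm 𝒮ℒ 12).mcast rfl hΓ
  have hle : ((Gamma N' : Subgroup SL(2, ℤ)) : Subgroup (GL (Fin 2) ℝ)) ≤
      (((⊤ : Subgroup SL(2, ℤ)) : Subgroup (GL (Fin 2) ℝ))) := Subgroup.map_mono le_top
  obtain ⟨D, hD⟩ := exists_modularForm_restrict hle (12 * (j : ℤ)) ((Δ₁.pow j).mcast (by ring))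
  exact ⟨D, by rw [hD, ModularForm.coe_mcast, ModularForm.coe_pow]; rfl⟩

/-- Level-`Γ(N')` functions are closed under multiplication: `F/Δᵐ · F'/Δ^{m'} = (F F')/Δ^{m+m'}`.
[cite: CalegariDimitrovTang2025, proof of Lemma 4.2.3] -/
theorem isLvl_mul {x y : Mer}
    (hx : ∃ (m : ℕ) (F : ModularForm ((Gamma N' : Subgroup SL(2, ℤ)) : Subgroup (GL (Fin 2) ℝ))
      (12 * (m : ℤ))), x = algebraMap hol Mer (modFun m F))
    (hy : ∃ (m : ℕ) (F : ModularForm ((Gamma N' : Subgroup SL(2, ℤ)) : Subgroup (GL (Fin 2) ℝ))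
      (12 * (m : ℤ))), y = algebraMap hol Mer (modFun m F)) :
    ∃ (m : ℕ) (F : ModularForm ((Gamma N' : Subgroup SL(2, ℤ)) : Subgroup (GL (Fin 2) ℝ))
      (12 * (m : ℤ))), x * y = algebraMap hol Mer (modFun m F) := by
  obtain ⟨m, F, rfl⟩ := hx
  obtain ⟨m', F', rfl⟩ := hy
  have e : 12 * (m : ℤ) + 12 * (m' : ℤ) = 12 * ((m + m' : ℕ) : ℤ) := by push_cast; ring
  refine ⟨m + m', (F.mul F').mcast e, ?_⟩
  rw [← map_mul]
  congr 1
  ext τ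
  simp only [Subalgebra.coe_mul, Pi.mul_apply, modFun_apply, ModularForm.coe_mcast,
    ModularForm.coe_mul, pow_add, div_mul_div_comm]

/-- Level-`Γ(N')` functions are closed under addition:
`F/Δᵐ + F'/Δ^{m'} = (F Δ^{m'} + F' Δᵐ)/Δ^{m+m'}`. [cite: CalegariDimitrovTang2025, proof of
Lemma 4.2.3] -/
theorem isLvl_add {x y : Mer}
    (hx : ∃ (m : ℕ) (F : ModularForm ((Gamma N' : Subgroup SL(2, ℤ)) : Subgroup (GL (Fin 2) ℝ))
      (12 * (m : ℤ))), x = algebraMap hol Mer (modFun m F))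
    (hy : ∃ (m : ℕ) (F : ModularForm ((Gamma N' : Subgroup SL(2, ℤ)) : Subgroup (GL (Fin 2) ℝ))
      (12 * (m : ℤ))), y = algebraMap hol Mer (modFun m F)) :
    ∃ (m : ℕ) (F : ModularForm ((Gamma N' : Subgroup SL(2, ℤ)) : Subgroup (GL (Fin 2) ℝ))
      (12 * (m : ℤ))), x + y = algebraMap hol Mer (modFun m F) := by
  obtain ⟨m, F, rfl⟩ := hx
  obtain ⟨m', F', rfl⟩ := hy
  obtain ⟨D, hD⟩ := exists_discriminant_pow_Gamma N' m
  obtain ⟨D', hD'⟩ := exists_discriminant_pow_Gamma N' m'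
  have e₁ : 12 * (m : ℤ) + 12 * (m' : ℤ) = 12 * ((m + m' : ℕ) : ℤ) := by push_cast; ring
  have e₂ : 12 * (m' : ℤ) + 12 * (m : ℤ) = 12 * ((m + m' : ℕ) : ℤ) := by push_cast; ring
  refine ⟨m + m', (F.mul D').mcast e₁ + (F'.mul D).mcast e₂, ?_⟩
  rw [← map_add]
  congr 1
  ext τ
  have hΔ : ModularForm.discriminant τ ≠ 0 := ModularForm.discriminant_ne_zero τ
  simp only [Subalgebra.coe_add, Pi.add_apply, modFun_apply, ModularForm.coe_add,
    ModularForm.coe_mcast, ModularForm.coe_mul, Pi.mul_apply, hD, hD', Pi.pow_apply, pow_add]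
  field_simp

/-- Scalar multiples of level-`Γ(N')` functions. [cite: CalegariDimitrovTang2025, proof of
Lemma 4.2.3] -/
theorem isLvl_smul_const (c : ℂ) {x : Mer}
    (hx : ∃ (m : ℕ) (F : ModularForm ((Gamma N' : Subgroup SL(2, ℤ)) : Subgroup (GL (Fin 2) ℝ))
      (12 * (m : ℤ))), x = algebraMap hol Mer (modFun m F)) :
    ∃ (m : ℕ) (F : ModularForm ((Gamma N' : Subgroup SL(2, ℤ)) : Subgroup (GL (Fin 2) ℝ))
      (12 * (m : ℤ))), c • x = algebraMap hol Mer (modFun m F) := by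
  obtain ⟨m, F, rfl⟩ := hx
  refine ⟨m, c • F, ?_⟩
  rw [Algebra.smul_def, IsScalarTower.algebraMap_apply ℂ hol Mer, ← map_mul, ← Algebra.smul_def]
  congr 1
  ext τ
  simp only [Subalgebra.coe_smul, Pi.smul_apply, smul_eq_mul, modFun_apply,
    ModularForm.IsGLPos.smul_apply, mul_div_assoc]

/-- `0` is a level-`Γ(N')` function. [folklore] -/
private theorem isLvl_zero :
    ∃ (m : ℕ) (F : ModularForm ((Gamma N' : Subgroup SL(2, ℤ)) : Subgroup (GL (Fin 2) ℝ))
      (12 * (m : ℤ))), (0 : Mer) = algebraMap hol Mer (modFun m F) := by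
  refine ⟨0, 0, ?_⟩
  rw [eq_comm, map_eq_zero_iff _ algebraMap_hol_injective]
  apply Subtype.ext
  change (⇑(0 : ModularForm _ (12 * ((0 : ℕ) : ℤ))) / (⇑CuspForm.discriminant) ^ 0) = (0 : ℍ → ℂ)
  funext τ
  rw [Pi.div_apply, ModularForm.coe_zero, Pi.zero_apply, zero_div]

/-- Generators of `M_{N'}` are level-`Γ(N')` functions (restrict the form to `Γ(N')`).
[cite: CalegariDimitrovTang2025, Definition 4.2.1] -/
theorem isLvl_of_mem_levelGens {u : Mer} (hu : u ∈ levelGens N') :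
    ∃ (m : ℕ) (F : ModularForm ((Gamma N' : Subgroup SL(2, ℤ)) : Subgroup (GL (Fin 2) ℝ))
      (12 * (m : ℤ))), u = algebraMap hol Mer (modFun m F) := by
  obtain ⟨G, hG, m, F, hle, -, rfl⟩ := hu
  obtain ⟨F', hF'⟩ := exists_modularForm_restrict
    (Subgroup.map_mono hle : ((Gamma N' : Subgroup SL(2, ℤ)) : Subgroup (GL (Fin 2) ℝ)) ≤
      (G : Subgroup (GL (Fin 2) ℝ))) _ F
  exact ⟨m, F', by rw [modFun_eq_of_coe_eq m hF']⟩

/-- `1` is a level-`Γ(N')` function. [folklore] -/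
private theorem isLvl_one :
    ∃ (m : ℕ) (F : ModularForm ((Gamma N' : Subgroup SL(2, ℤ)) : Subgroup (GL (Fin 2) ℝ))
      (12 * (m : ℤ))), (1 : Mer) = algebraMap hol Mer (modFun m F) :=
  isLvl_of_mem_levelGens (one_mem_levelGens N')

/-- **Elements of the `ℂ`-span of the generators of `M_{N'}` are level-`Γ(N')` functions**
`F/Δᵐ`, `F ∈ M_{12m}(Γ(N'))` (common denominator). [cite: CalegariDimitrovTang2025, proof of
Lemma 4.2.3] -/
theorem isLvl_of_mem_span {x : Mer} (hx : x ∈ Submodule.span ℂ (levelGens N')) :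
    ∃ (m : ℕ) (F : ModularForm ((Gamma N' : Subgroup SL(2, ℤ)) : Subgroup (GL (Fin 2) ℝ))
      (12 * (m : ℤ))), x = algebraMap hol Mer (modFun m F) := by
  induction hx using Submodule.span_induction with
  | mem u hu => exact isLvl_of_mem_levelGens hu
  | zero => exact isLvl_zero
  | add x y _ _ hx hy => exact isLvl_add hx hy
  | smul c x _ hx => exact isLvl_smul_const c hx

/-- **Level-`Γ(N')` functions are stable under all of `SL(2, ℤ)`**: `γ • (F/Δᵐ) = (F ∣ γ⁻¹)/Δᵐ`
with `F ∣ γ⁻¹ ∈ M_{12m}(Γ(N'))`. [cite: CalegariDimitrovTang2025, Lemma 4.2.3] -/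
theorem isLvl_smul (γ : SL(2, ℤ)) {x : Mer}
    (hx : ∃ (m : ℕ) (F : ModularForm ((Gamma N' : Subgroup SL(2, ℤ)) : Subgroup (GL (Fin 2) ℝ))
      (12 * (m : ℤ))), x = algebraMap hol Mer (modFun m F)) :
    ∃ (m : ℕ) (F : ModularForm ((Gamma N' : Subgroup SL(2, ℤ)) : Subgroup (GL (Fin 2) ℝ))
      (12 * (m : ℤ))), γ • x = algebraMap hol Mer (modFun m F) := by
  obtain ⟨m, F, rfl⟩ := hx
  obtain ⟨F', hF'⟩ := exists_translate F γ⁻¹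
  refine ⟨m, F', ?_⟩
  have h := smul_modFun_eq_of_coe_eq_slash F F' γ⁻¹ hF'
  rw [inv_inv] at h
  rw [smul_algebraMap, h]

/-- Finite products of level-`Γ(N')` functions. [folklore] -/
private theorem isLvl_prod {ι : Type*} (s : Finset ι) (f : ι → Mer)
    (h : ∀ i ∈ s, ∃ (m : ℕ) (F : ModularForm ((Gamma N' : Subgroup SL(2, ℤ)) :
      Subgroup (GL (Fin 2) ℝ)) (12 * (m : ℤ))), f i = algebraMap hol Mer (modFun m F)) :
    ∃ (m : ℕ) (F : ModularForm ((Gamma N' : Subgroup SL(2, ℤ)) : Subgroup (GL (Fin 2) ℝ))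
      (12 * (m : ℤ))), ∏ i ∈ s, f i = algebraMap hol Mer (modFun m F) := by
  classical
  induction s using Finset.induction_on with
  | empty => simpa using (isLvl_one (N' := N'))
  | insert a s ha ih =>
    rw [Finset.prod_insert ha]
    exact isLvl_mul (h a (Finset.mem_insert_self a s))
      (ih fun i hi ↦ h i (Finset.mem_insert_of_mem hi))

/-- Level-`Γ(N')` functions are `Γ(N')`-invariant. [cite: CalegariDimitrovTang2025,
Definition 4.2.1] -/
theorem mem_invariantField_of_isLvl {x : Mer}
    (hx : ∃ (m : ℕ) (F : ModularForm ((Gamma N' : Subgroup SL(2, ℤ)) : Subgroup (GL (Fin 2) ℝ))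
      (12 * (m : ℤ))), x = algebraMap hol Mer (modFun m F)) :
    x ∈ invariantField (Gamma N') := by
  obtain ⟨m, F, rfl⟩ := hx
  exact algebraMap_modFun_mem_invariantField F

end level

/-! ### §2. Under the rationality hypothesis: `M_{N'}` is stable under `SL(2, ℤ)` -/

/-- **`M_{N'}` is stable under `SL(2, ℤ)`**, granted the rationality input `hrat` at level `N'`
(every `F/Δᵐ`, `F ∈ M_{12m}(Γ(N'))`, lies in `M_{N'}`): an element of `M_{N'}` is a quotient of two
elements of the span of the generators, which are level-`Γ(N')` functions, a class stable under
`SL(2, ℤ)`. This is the function-field shadow of "`Y(N) → Y(1)` is Galois".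
[cite: CalegariDimitrovTang2025, Lemma 4.2.3] -/
theorem smul_mem_levelField {N' : ℕ} (hN' : N' ≠ 0)
    (hrat : ∀ (m : ℕ) (F : ModularForm ((Gamma N' : Subgroup SL(2, ℤ)) : Subgroup (GL (Fin 2) ℝ))
      (12 * (m : ℤ))), algebraMap hol Mer (modFun m F) ∈ levelField N')
    (γ : SL(2, ℤ)) {x : Mer} (hx : x ∈ levelField N') : γ • x ∈ levelField N' := by
  obtain ⟨a, ha, b, hb, rfl⟩ := (mem_levelField_iff hN').mp hx
  rw [div_eq_mul_inv, smul_mul', smul_inv'', ← div_eq_mul_inv]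
  obtain ⟨m, F, hF⟩ := isLvl_smul γ (isLvl_of_mem_span ha)
  obtain ⟨m', F', hF'⟩ := isLvl_smul γ (isLvl_of_mem_span hb)
  rw [hF, hF']
  exact div_mem (hrat m F) (hrat m' F')

/-! ### §3. The fixed field of `Γ(N)` on `M_{N'}` is `M_N` -/

/-- A level-`Γ(N')` function fixed by `Γ(N)` is a level-`Γ(N)` function, hence in `M_N` (granted the
rationality input `hrat` at level `N`): bundle the form on `Γ(N)`.
[cite: CalegariDimitrovTang2025, Lemma 4.2.3] -/
theorem mem_levelField_of_isLvl_of_forall_smul_eq {N N' : ℕ} (hN : N ≠ 0) (hN' : N' ≠ 0)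
    (hrat : ∀ (m : ℕ) (F : ModularForm ((Gamma N : Subgroup SL(2, ℤ)) : Subgroup (GL (Fin 2) ℝ))
      (12 * (m : ℤ))), algebraMap hol Mer (modFun m F) ∈ levelField N)
    {x : Mer}
    (hx : ∃ (m : ℕ) (F : ModularForm ((Gamma N' : Subgroup SL(2, ℤ)) : Subgroup (GL (Fin 2) ℝ))
      (12 * (m : ℤ))), x = algebraMap hol Mer (modFun m F))
    (hfix : ∀ γ ∈ Gamma N, γ • x = x) : x ∈ levelField N := by
  haveI : NeZero N := ⟨hN⟩
  haveI : NeZero N' := ⟨hN'⟩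
  obtain ⟨m, F, rfl⟩ := hx
  have hfix' : ∀ γ ∈ Gamma N, γ • modFun m F = modFun m F := fun γ hγ ↦
    algebraMap_hol_injective (by rw [← smul_algebraMap]; exact hfix γ hγ)
  obtain ⟨F', hF'⟩ := exists_modularForm_of_forall_smul_modFun_eq (Γ' := Gamma N) F hfix'
  rw [modFun_eq_of_coe_eq m hF'.symm]
  exact hrat m F'

/-- ★ **The fixed field of `Γ(N)` on `M_{N'}` is contained in `M_N`** — "`M_N` may be identified with
the field of rational functions on `Y(N)`" in the relative form needed for Theorem 4.3.2 — granted
the rationality input `hrat` at level `N`. Proof (norm trick): write `x = a/b` with `a, b` in the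
span of the generators of `M_{N'}` (level-`Γ(N')` functions); `b̃ = ∏_{σ ∈ SL₂(ℤ)/Γ(N')} σ • b` is a
non-zero level-`Γ(N')` function fixed by all of `SL(2, ℤ)`, and `x b̃ = a ∏_{σ ≠ 1} σ • b` is a
level-`Γ(N')` function fixed by `Γ(N)`; both are therefore in `M_N`, and `x = (x b̃)/b̃`.
[cite: CalegariDimitrovTang2025, Lemma 4.2.3 and §4.3 ("the intersection of `M_{Np}` and `R_N` is
`M_N`")] -/
theorem levelField_inf_invariantField_Gamma_le_levelField {N N' : ℕ} (hN : N ≠ 0) (hN' : N' ≠ 0)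
    (hrat : ∀ (m : ℕ) (F : ModularForm ((Gamma N : Subgroup SL(2, ℤ)) : Subgroup (GL (Fin 2) ℝ))
      (12 * (m : ℤ))), algebraMap hol Mer (modFun m F) ∈ levelField N) :
    levelField N' ⊓ invariantField (Gamma N) ≤ levelField N := by
  classical
  haveI : NeZero N' := ⟨hN'⟩
  intro x hx
  obtain ⟨hxL, hxI⟩ := IntermediateField.mem_inf.mp hx
  obtain ⟨a, ha, b, hb, rfl⟩ := (mem_levelField_iff hN').mp hxL
  have haL := isLvl_of_mem_span ha
  have hbL := isLvl_of_mem_span hb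
  by_cases hb0 : b = 0
  · rw [hb0, div_zero]
    exact zero_mem _
  -- the norm of `b` over `SL(2, ℤ)/Γ(N')`
  let Q := SL(2, ℤ) ⧸ Gamma N'
  haveI : Fintype Q := Fintype.ofFinite Q
  let nb : Q → Mer := fun q ↦ (q.out : SL(2, ℤ)) • b
  have hbfix : ∀ h ∈ Gamma N', h • b = b := fun h hh ↦
    mem_invariantField_iff.mp (mem_invariantField_of_isLvl hbL) h hh
  have hnb : ∀ g : SL(2, ℤ), nb (g : Q) = g • b := fun g ↦ by
    obtain ⟨h, hh⟩ := QuotientGroup.mk_out_eq_mul (Gamma N') g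
    change ((g : Q).out : SL(2, ℤ)) • b = g • b
    rw [hh, mul_smul, hbfix h h.2]
  have hnb_lvl : ∀ q : Q, ∃ (m : ℕ) (F : ModularForm ((Gamma N' : Subgroup SL(2, ℤ)) :
      Subgroup (GL (Fin 2) ℝ)) (12 * (m : ℤ))), nb q = algebraMap hol Mer (modFun m F) :=
    fun q ↦ isLvl_smul _ hbL
  let bt : Mer := ∏ q : Q, nb q
  have hbt_fix : ∀ γ : SL(2, ℤ), γ • bt = bt := fun γ ↦ by
    simp only [bt, Finset.smul_prod']
    refine Fintype.prod_equiv (MulAction.toPerm γ) _ _ fun q ↦ ?_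
    change γ • ((q.out : SL(2, ℤ)) • b) = nb (γ • q)
    rw [← mul_smul, ← hnb, ← MulAction.Quotient.coe_smul_out, smul_eq_mul]
  have hbt_lvl := isLvl_prod (Finset.univ : Finset Q) nb fun q _ ↦ hnb_lvl q
  have hbt_ne : bt ≠ 0 := Finset.prod_ne_zero_iff.mpr fun q _ ↦ by
    change (q.out : SL(2, ℤ)) • b ≠ 0
    rwa [ne_eq, smul_eq_zero_iff_eq]
  -- `x · b̃` is a level-`Γ(N')` function: `x b̃ = a · ∏_{q ≠ 1} nb q`
  have hnb1 : nb ((1 : SL(2, ℤ)) : Q) = b := by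
    rw [hnb, one_smul]
  have hxbt_lvl : ∃ (m : ℕ) (F : ModularForm ((Gamma N' : Subgroup SL(2, ℤ)) :
      Subgroup (GL (Fin 2) ℝ)) (12 * (m : ℤ))), a / b * bt = algebraMap hol Mer (modFun m F) := by
    have heq : a / b * bt = a * ∏ q ∈ Finset.univ.erase ((1 : SL(2, ℤ)) : Q), nb q := by
      have hsplit : bt = b * ∏ q ∈ Finset.univ.erase ((1 : SL(2, ℤ)) : Q), nb q := by
        rw [← hnb1]
        exact (Finset.mul_prod_erase Finset.univ nb (Finset.mem_univ _)).symm
      rw [hsplit, ← mul_assoc, div_mul_cancel₀ a hb0]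
    rw [heq]
    exact isLvl_mul haL (isLvl_prod _ nb fun q _ ↦ hnb_lvl q)
  have hxbt_fix : ∀ γ ∈ Gamma N, γ • (a / b * bt) = a / b * bt := fun γ hγ ↦ by
    rw [smul_mul', mem_invariantField_iff.mp hxI γ hγ, hbt_fix]
  -- conclude
  have h1 : a / b * bt ∈ levelField N :=
    mem_levelField_of_isLvl_of_forall_smul_eq hN hN' hrat hxbt_lvl hxbt_fix
  have h2 : bt ∈ levelField N :=
    mem_levelField_of_isLvl_of_forall_smul_eq hN hN' hrat hbt_lvl fun γ _ ↦ hbt_fix γ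
  rw [show a / b = a / b * bt / bt from (mul_div_cancel_right₀ _ hbt_ne).symm]
  exact div_mem h1 h2

/-- **`M_{N'}^{Γ(N)} = M_N` for `N ∣ N'`** (granted `hrat` at level `N`): the fixed field of `Γ(N)`
acting on `M_{N'}` is exactly `M_N`. [cite: CalegariDimitrovTang2025, Lemma 4.2.3] -/
theorem levelField_inf_invariantField_Gamma_eq {N N' : ℕ} (hN : N ≠ 0) (hN' : N' ≠ 0) (hd : N ∣ N')
    (hrat : ∀ (m : ℕ) (F : ModularForm ((Gamma N : Subgroup SL(2, ℤ)) : Subgroup (GL (Fin 2) ℝ))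
      (12 * (m : ℤ))), algebraMap hol Mer (modFun m F) ∈ levelField N) :
    levelField N' ⊓ invariantField (Gamma N) = levelField N :=
  le_antisymm (levelField_inf_invariantField_Gamma_le_levelField hN hN' hrat)
    (le_inf (levelField_mono (Nat.pos_of_ne_zero hN) hd hN') (levelField_le_invariantField N))

/-! ### §4. "The intersection of `M_{Np}` and `R_N` is `M_N`" -/

/-- ★ **"The intersection of `M_{Np}` and `R_N` is `M_N`"** [cite: CalegariDimitrovTang2025, §4.3
(proof of Theorem 4.3.2)], for any multiple `N'` of `N`, granted the rationality input `hrat` at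
level `N` and finite generation of `R_N` (CDT: `[R_N : M_2] < ∞`): `R_N ⊓ M_{N'} = M_N`. (`R_N` is
fixed by a level-`N` group `G_N` and `M_{N'}` by the congruence subgroup `Γ(N')`, so the
intersection is fixed by `Γ(N)` — Wohlfahrt — and `M_{N'}^{Γ(N)} = M_N`.) -/
theorem bddDenField_inf_levelField_eq {N N' : ℕ} (hN : N ≠ 0) (hN' : N' ≠ 0) (hd : N ∣ N')
    (hrat : ∀ (m : ℕ) (F : ModularForm ((Gamma N : Subgroup SL(2, ℤ)) : Subgroup (GL (Fin 2) ℝ))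
      (12 * (m : ℤ))), algebraMap hol Mer (modFun m F) ∈ levelField N)
    (hfg : (bddDenField N).FG) :
    bddDenField N ⊓ levelField N' = levelField N := by
  refine le_antisymm (fun x hx ↦ ?_)
    (le_inf (levelField_le_bddDenField N) (levelField_mono (Nat.pos_of_ne_zero hN) hd hN'))
  exact levelField_inf_invariantField_Gamma_le_levelField hN hN' hrat (IntermediateField.mem_inf.mpr
    ⟨(IntermediateField.mem_inf.mp hx).2, bddDenField_inf_levelField_le_invariantField hN hN' hfg hx⟩)

end UnboundedDenominators

end Literature.NumberTheory.Automorphic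

end
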